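import Summits.CriticalPhenomena.PercolationContinuityZ3.Theorems.FK.WiredMinimalOnFiniteClustersBox
import Literature.Probability.Percolation.ConnectivityThetaSqProofs
import Mathlib.MeasureTheory.Integral.Indicator
import HarnessLib

/-!
# FK-continuity cell, FO-10a: on the finite clusters the WIRED measure is the smallest of the class —
# `φ¹_{p,q}(A; Λ ↛ ∞) ≤ P(A; Λ ↛ ∞)` for every `FKGibbs` measure `P` and every increasing `E_Λ`-local `A`
# (Grimmett 2006, proof of Thm. (5.16)(c), eq. (5.28) — coupling-free, infinite volume)

Registered R76 (cell INBOX l.5704, 2026-08-23); registry row FO-10a-g336; label THU-B (coordinator fk-4 g167).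
Cell `fk-continuity` (bschramm), row FO-10a (domain-Markov + comparison layer over FO-06); support file
for the FK-continuity transplant (`--supports stmt-CriticalPhenomena-4575`); builds on p205010 (kernel
theorem, internal audit signed; external expert review pending). Pure proofs; no definitions, no named
facts, no sorries; general dimension `d`.

From the box statement of `WiredMinimalOnFiniteClustersBox.lean` (`φ¹_{p,q}(A; Λ ↮ ∂Λ_n) ≤ P(A; Λ ↮ ∂Λ_n)`) by
`Λ_n ↑ ℤ^d`: for a lattice configuration, `Λ ↮ ∂Λ_n inside Λ_n` holds for all large `n` iff every cluster of `Λ`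
is finite (`eventually_mem_setOf_forall_not_bdryReach_iff`, via the exit lemma `bdryReach_of_reachable_of_notMem`),
so both sides converge (`tendsto_real_inter_setOf_forall_not_bdryReach`, dominated convergence of indicators) and

  **`φ¹_{p,q}(A ∩ {∀ x ∈ Λ, |C_x| < ∞}) ≤ P(A ∩ {∀ x ∈ Λ, |C_x| < ∞})`**  (`FKGibbs.rcLimit_true_real_inter_finiteClusters_le`)

for every `P` of the class `FKGibbs d p q` (`0 ≤ p ≤ 1`, `q ≥ 1`), every finite `Λ` and every increasing `A`
determined by `E_Λ`; in particular `φ¹_{p,q}(A; Λ ↛ ∞) ≤ φ⁰_{p,q}(A; Λ ↛ ∞)`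
(`rcLimit_true_real_inter_finiteClusters_le_rcLimit_false`) — the reverse of Lemma (4.14)(b) on finite clusters.
With `Λ = {u, v}`, `A = {e open}` this is the step `φ¹(J_e; u ↛ ∞, v ↛ ∞) ≤ φ⁰(J_e; u ↛ ∞, v ↛ ∞)` (eq. (5.28))
of the proof of Thm. (5.16)(c), completed in `UniquenessOfEqualTheta.lean`; the last section records the
deterministic one-edge facts used there. When `φ¹_{p,q}` does not percolate, `{Λ ↛ ∞}` is almost sure and the
inequality is `UniquenessOfNonPercolation.lean`'s `rcLimit_true_real_le_of_forall_percolatesAt_eq_zero`.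

## References
* G. Grimmett, *The Random-Cluster Model*, Springer 2006 (`book:grimmett2006-random-cluster-model`): §5.2,
  proof of Thm. (5.16)(c), eqs. (5.22)–(5.29) and Prop. (5.30) [PDF pp. 103–107]; Thm. (4.33)(c). [Grimmett2006]
-/

noncomputable section

open MeasureTheory Set Filter
open scoped Topology ENNReal

namespace Summit.CriticalPhenomena.PercolationContinuityZ3.Theorems.FK

open Literature.Probability.Percolation Literature.Probability.LatticeModels


/-! ## To infinite volume: `Δ = Λ_n ↑ ℤ^d` -/

section Limit

variable {d : ℕ}

/-- **Exit lemma**: a lattice configuration joining `x ∈ Λ` to a vertex outside the finite region `Λ`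
joins `x` to `∂Λ` inside `Λ` (the walk's last vertex before it first leaves `Λ`). [cite: Grimmett2006, §5.2, proof of Thm. (5.16)(c) ({u ↔ ∂Λ} is a cylinder event)] -/
theorem bdryReach_of_reachable_of_notMem {ω : BondConfig (Site d)} (hω : ω ⊆ (zdGraph d).edgeSet)
    {Λ : Finset (Site d)} {x z : Site d} (hx : x ∈ Λ) (hz : z ∉ Λ) (hxz : (openGraph ω).Reachable x z) :
    ∃ y ∈ innerBoundary (zdGraph d) Λ,
      (openGraph ω ⊓ withinGraph (zdGraph d) (↑Λ : Set (Site d))).Reachable y x := by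
  classical
  obtain ⟨w⟩ := hxz
  set S : Set (Site d) :=
    {c | (openGraph ω ⊓ withinGraph (zdGraph d) (↑Λ : Set (Site d))).Reachable x c} with hS
  have hxS : x ∈ S := SimpleGraph.Reachable.refl _
  -- every vertex of `S` lies in `Λ` (the steps of the graph inside `Λ` stay in `Λ`)
  have hSΛ : ∀ c ∈ S, c ∈ Λ := fun c hc =>
    Finset.mem_coe.1 (mem_of_reachable_of_forall_adj_mem (r := (↑Λ : Set (Site d)))
      (fun a b _ hab => by
        rw [SimpleGraph.inf_adj, withinGraph_adj] at hab
        exact hab.2.2.2)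
      (Finset.mem_coe.2 hx) hc)
  have hzS : z ∉ S := fun h => hz (hSΛ z h)
  obtain ⟨dt, -, haS, hbS⟩ := w.exists_boundary_dart S hxS hzS
  have hadj := dt.adj
  rw [openGraph_adj] at hadj
  have hlat : (zdGraph d).Adj dt.toProd.1 dt.toProd.2 := by
    have := hω hadj.1
    rwa [SimpleGraph.mem_edgeSet] at this
  have haΛ : dt.toProd.1 ∈ Λ := hSΛ _ haS
  -- the endpoint `b` of the boundary dart is outside `Λ`
  have hbΛ : dt.toProd.2 ∉ Λ := by
    intro hbΛ
    refine hbS (SimpleGraph.Reachable.trans haS (SimpleGraph.Adj.reachable ?_))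
    rw [SimpleGraph.inf_adj, openGraph_adj, withinGraph_adj]
    exact ⟨hadj, hlat, Finset.mem_coe.2 haΛ, Finset.mem_coe.2 hbΛ⟩
  refine ⟨dt.toProd.1, mem_innerBoundary_iff.2 ⟨haΛ, dt.toProd.2, hbΛ, hlat⟩, ?_⟩
  exact SimpleGraph.Reachable.symm haS

/-- **Almost surely, `Λ ↮ ∂Λ_n` for all large `n` iff all clusters of `Λ` are finite**: for a lattice
configuration `ω` and a finite `Λ`, eventually in `n`,
`(∀ x ∈ Λ, x ↮ ∂Λ_n inside Λ_n) ↔ (∀ x ∈ Λ, |C_x(ω)| < ∞)`. [cite: Grimmett2006, §5.2, proof of Thm. (5.16)(c) (A_Λ → {u ↮ ∞, v ↮ ∞} as Λ ↑ ℤ^d)] -/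
theorem eventually_mem_setOf_forall_not_bdryReach_iff {ω : BondConfig (Site d)}
    (hω : ω ⊆ (zdGraph d).edgeSet) (Λ : Finset (Site d)) :
    ∀ᶠ n : ℕ in atTop,
      (ω ∈ {ω : BondConfig (Site d) | ∀ x ∈ Λ, ¬ ∃ y ∈ innerBoundary (zdGraph d) (box d n),
          (openGraph ω ⊓ withinGraph (zdGraph d) (↑(box d n) : Set (Site d))).Reachable y x}) ↔
        ω ∈ {ω : BondConfig (Site d) | ∀ x ∈ Λ, ω ∉ percolatesAt x} := by
  classical
  by_cases hfin : ∀ x ∈ Λ, ω ∉ percolatesAt x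
  · -- all clusters of `Λ` are finite: they lie in a box `Λ_m`, and `∂Λ_n ∩ Λ_m = ∅` for `n > m`
    have hfin' : ∀ x ∈ Λ, (openCluster ω x).Finite := fun x hx => by
      have := hfin x hx
      rwa [percolatesAt, Set.mem_setOf_eq, Set.not_infinite] at this
    set S : Set (Site d) := ⋃ x ∈ Λ, openCluster ω x with hS
    have hSfin : S.Finite := Set.Finite.biUnion (Finset.finite_toSet Λ) fun x hx => hfin' x hx
    set m : ℕ := hSfin.toFinset.sup siteRad with hm
    have hSm : ∀ c ∈ S, c ∈ box d m := fun c hc =>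
      subset_box_of_sup_siteRad_le le_rfl (hSfin.mem_toFinset.2 hc)
    filter_upwards [eventually_gt_atTop m] with n hn
    refine ⟨fun _ => hfin, fun _ x hx => ?_⟩
    rintro ⟨y, hy, hyx⟩
    have hyS : y ∈ S := by
      rw [hS, Set.mem_iUnion₂]
      exact ⟨x, hx, (hyx.mono inf_le_left).symm⟩
    exact notMem_innerBoundary_box_of_mem_box hn (hSm y hyS) hy
  · -- some `x ∈ Λ` has an infinite cluster: it leaves every box, hence reaches `∂Λ_n` inside `Λ_n`
    push Not at hfin
    obtain ⟨x, hx, hxperc⟩ := hfin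
    filter_upwards [eventually_ge_atTop (Λ.sup siteRad)] with n hn
    constructor
    · intro h
      exfalso
      have hxn : x ∈ box d n := subset_box_of_sup_siteRad_le hn hx
      have hinf : (openCluster ω x).Infinite := hxperc
      obtain ⟨z, hz, hzn⟩ := hinf.exists_notMem_finset (box d n)
      exact h x hx (bdryReach_of_reachable_of_notMem hω hxn hzn hz)
    · intro h
      exact (h x hx hxperc).elim

/-- **Both sides converge**: for a finite measure `μ` carried by lattice configurations, a measurable `A`
and a finite `Λ`, `μ(A ∩ {Λ ↮ ∂Λ_n inside Λ_n}) → μ(A ∩ {all clusters of Λ finite})` as `n → ∞`.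
[cite: Grimmett2006, §5.2, proof of Thm. (5.16)(c) (Λ ↑ ℤ^d)] -/
theorem tendsto_real_inter_setOf_forall_not_bdryReach (μ : Measure (BondConfig (Site d))) [IsFiniteMeasure μ]
    (hμ : ∀ᵐ ω ∂μ, ω ⊆ (zdGraph d).edgeSet) {A : Set (BondConfig (Site d))} (hA : MeasurableSet A)
    (Λ : Finset (Site d)) :
    Tendsto (fun n : ℕ => μ.real (A ∩ {ω | ∀ x ∈ Λ, ¬ ∃ y ∈ innerBoundary (zdGraph d) (box d n),
        (openGraph ω ⊓ withinGraph (zdGraph d) (↑(box d n) : Set (Site d))).Reachable y x})) atTop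
      (𝓝 (μ.real (A ∩ {ω | ∀ x ∈ Λ, ω ∉ percolatesAt x}))) := by
  have hEm : ∀ n : ℕ, MeasurableSet {ω : BondConfig (Site d) | ∀ x ∈ Λ,
      ¬ ∃ y ∈ innerBoundary (zdGraph d) (box d n),
        (openGraph ω ⊓ withinGraph (zdGraph d) (↑(box d n) : Set (Site d))).Reachable y x} := by
    intro n
    have : {ω : BondConfig (Site d) | ∀ x ∈ Λ, ¬ ∃ y ∈ innerBoundary (zdGraph d) (box d n),
        (openGraph ω ⊓ withinGraph (zdGraph d) (↑(box d n) : Set (Site d))).Reachable y x} =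
        ⋂ x ∈ Λ, {ω | ¬ ∃ y ∈ innerBoundary (zdGraph d) (box d n),
          (openGraph ω ⊓ withinGraph (zdGraph d) (↑(box d n) : Set (Site d))).Reachable y x} := by
      ext ω; simp only [Set.mem_setOf_eq, Set.mem_iInter]
    rw [this]
    refine MeasurableSet.biInter (Finset.countable_toSet Λ) fun x _ => ?_
    have hloc : IsLocalEvent {ω : BondConfig (Site d) | ∃ y ∈ innerBoundary (zdGraph d) (box d n),
        (openGraph ω ⊓ withinGraph (zdGraph d) (↑(box d n) : Set (Site d))).Reachable y x} :=
      ⟨_, determinedBy_setOf_bdryReach (box d n) x⟩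
    exact (measurableSet_of_isLocalEvent_holds hloc).compl
  have hFm : MeasurableSet {ω : BondConfig (Site d) | ∀ x ∈ Λ, ω ∉ percolatesAt x} := by
    have : {ω : BondConfig (Site d) | ∀ x ∈ Λ, ω ∉ percolatesAt x} = ⋂ x ∈ Λ, (percolatesAt x)ᶜ := by
      ext ω; simp only [Set.mem_setOf_eq, Set.mem_iInter, Set.mem_compl_iff]
    rw [this]
    exact MeasurableSet.biInter (Finset.countable_toSet Λ) fun x _ => (measurableSet_percolatesAt_holds x).compl
  have h := tendsto_measure_of_ae_tendsto_indicator_of_isFiniteMeasure (μ := μ) atTop (hA.inter hFm)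
    (fun n => hA.inter (hEm n)) ?_
  · exact (ENNReal.tendsto_toReal (measure_ne_top μ _)).comp h
  · filter_upwards [hμ] with ω hω
    filter_upwards [eventually_mem_setOf_forall_not_bdryReach_iff hω Λ] with n hn
    simp only [Set.mem_inter_iff]
    exact and_congr_right fun _ => hn

end Limit

/-! ## The theorem: on the finite clusters of `Λ`, `φ¹_{p,q}` is the smallest measure of the class -/

section Main

variable {d : ℕ} {p q : ℝ} {P : Measure (BondConfig (Site d))}

/-- **On finite clusters the wired measure is minimal** (coupling-free form of Grimmett 2006, Prop. (5.30)
and the display following it, in infinite volume): for every `P` of the class `FKGibbs d p q`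
(`0 ≤ p ≤ 1`, `q ≥ 1`), every finite `Λ ⊆ ℤ^d` and every increasing event `A` determined by `E_Λ`,
`φ¹_{p,q}(A ∩ {∀ x ∈ Λ, |C_x| < ∞}) ≤ P(A ∩ {∀ x ∈ Λ, |C_x| < ∞})`.
[cite: Grimmett2006, §5.2, Prop. (5.30) and the proof of Thm. (5.16)(c), eq. (5.28)] -/
theorem FKGibbs.rcLimit_true_real_inter_finiteClusters_le (hP : FKGibbs d p q P)
    (hp : p ∈ Set.Icc (0 : ℝ) 1) (hq : 1 ≤ q) {Λ : Finset (Site d)} {A : Set (BondConfig (Site d))}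
    (hA : IsUpperSet A) (hAΛ : DeterminedBy A ↑(edgesIn (zdGraph d) Λ)) :
    (rcLimit d true p q).real (A ∩ {ω | ∀ x ∈ Λ, ω ∉ percolatesAt x}) ≤
      P.real (A ∩ {ω | ∀ x ∈ Λ, ω ∉ percolatesAt x}) := by
  haveI := hP.isProbabilityMeasure
  haveI := isProbabilityMeasure_rcLimit true p q (d := d)
  have hAm : MeasurableSet A := measurableSet_of_isLocalEvent_holds ⟨_, hAΛ⟩
  have h1 := tendsto_real_inter_setOf_forall_not_bdryReach (rcLimit d true p q)
    ((isBoxLimit_rcLimit true hp hq).ae_subset_edgeSet hp (one_pos.trans_le hq)) hAm Λ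
  have h2 := tendsto_real_inter_setOf_forall_not_bdryReach P hP.ae_subset_edgeSet hAm Λ
  refine le_of_tendsto_of_tendsto h1 h2 ?_
  filter_upwards [eventually_ge_atTop (Λ.sup siteRad)] with n hn
  exact hP.rcLimit_true_real_inter_setOf_forall_not_bdryReach_le hp hq (subset_box_of_sup_siteRad_le hn) hA hAΛ

/-- **`φ¹_{p,q}(A; Λ ↛ ∞) ≤ φ⁰_{p,q}(A; Λ ↛ ∞)`**: on the finite clusters of `Λ` the wired measure lies
BELOW the free one on increasing `E_Λ`-local events (`0 ≤ p ≤ 1`, `q ≥ 1`, every `d`) — the reverse of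
Lemma (4.14)(b). [cite: Grimmett2006, §5.2, proof of Thm. (5.16)(c), eq. (5.28) with Prop. (5.30)] -/
theorem rcLimit_true_real_inter_finiteClusters_le_rcLimit_false (hp : p ∈ Set.Icc (0 : ℝ) 1) (hq : 1 ≤ q)
    {Λ : Finset (Site d)} {A : Set (BondConfig (Site d))} (hA : IsUpperSet A)
    (hAΛ : DeterminedBy A ↑(edgesIn (zdGraph d) Λ)) :
    (rcLimit d true p q).real (A ∩ {ω | ∀ x ∈ Λ, ω ∉ percolatesAt x}) ≤
      (rcLimit d false p q).real (A ∩ {ω | ∀ x ∈ Λ, ω ∉ percolatesAt x}) :=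
  ((isBoxLimit_rcLimit false hp hq).fkGibbs hp hq).rcLimit_true_real_inter_finiteClusters_le hp hq hA hAΛ

end Main

/-! ## Deterministic facts about one edge `e = ⟨u,v⟩` -/

section Deterministic

variable {d : ℕ}

/-- If `e = ⟨u,v⟩` is open, `u ↔ ∞` iff `v ↔ ∞` (the clusters coincide). [cite: Grimmett2006, §5.2, proof of Thm. (5.16)(c) (J_e ∩ Ī_u ∩ I_v = ∅)] -/
theorem mem_percolatesAt_iff_of_mem {u v : Site d} (huv : u ≠ v) {ω : BondConfig (Site d)} (he : s(u, v) ∈ ω) :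
    ω ∈ percolatesAt u ↔ ω ∈ percolatesAt v := by
  have hadj : (openGraph ω).Adj u v := by rw [openGraph_adj]; exact ⟨he, huv⟩
  have hC : openCluster ω u = openCluster ω v := by
    ext y
    simp only [openCluster, Set.mem_setOf_eq]
    exact ⟨fun h => hadj.symm.reachable.trans h, fun h => hadj.reachable.trans h⟩
  simp only [percolatesAt, Set.mem_setOf_eq, hC]

/-- Off `J_e`, deleting `e` does nothing: `ω ∉ J_e ⇒ ω ∖ e = ω`. [folklore] -/
theorem diff_singleton_eq_self_of_notMem {e : Sym2 (Site d)} {ω : BondConfig (Site d)} (he : e ∉ ω) :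
    ω \ {e} = ω := Set.sdiff_singleton_eq_self he

/-- The preimage under "close the edge `e`" of an event determined by `S` is determined by `S ∖ {e}`.
[cite: Grimmett2006, §4.4 (the σ-field T_e of events off e)] -/
theorem determinedBy_preimage_diff_singleton {A : Set (BondConfig (Site d))} {S : Set (Sym2 (Site d))}
    (hA : DeterminedBy A S) (e : Sym2 (Site d)) :
    DeterminedBy ((fun η : BondConfig (Site d) => η \ {e}) ⁻¹' A) (S \ {e}) := by
  rw [determinedBy_iff] at hA ⊢
  intro ω ω' h
  simp only [Set.mem_preimage]
  refine hA _ _ ?_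
  have key : ∀ η : BondConfig (Site d), η \ {e} ∩ S = η ∩ (S \ {e}) := fun η => by
    ext x
    simp only [Set.mem_inter_iff, Set.mem_sdiff, Set.mem_singleton_iff]
    tauto
  rw [key, key, h]

/-- Two percolating sites of a configuration with at most one infinite cluster are joined; so
`{u ↔ ∞, v ↔ ∞, u ↮ v in ω ∖ e} ⊆ {ω ∖ e has ≥ 2 infinite clusters}`. [cite: Grimmett2006, Thm. (4.33)(c) and §5.2 (5.24)] -/
theorem preimage_diff_percolatesAt_inter_diff_openConn_subset (u v : Site d) (e : Sym2 (Site d)) :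
    (fun η : BondConfig (Site d) => η \ {e}) ⁻¹' (percolatesAt u ∩ percolatesAt v) \
        (fun η : BondConfig (Site d) => η \ {e}) ⁻¹' openConn u v ⊆
      (fun η : BondConfig (Site d) => η \ {e}) ⁻¹' {ω | ¬ numInfiniteClusters ω ≤ 1} := by
  rintro ω ⟨⟨hu, hv⟩, huv⟩
  exact fun hN => huv (mem_openConn_of_numInfiniteClusters_le_one hN hu hv)

end Deterministic

end Summit.CriticalPhenomena.PercolationContinuityZ3.Theorems.FK

end
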